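import Literature.NumberTheory.IwasawaTheory.CyclotomicTwoTowerOddPrimeDecomposition
import Literature.NumberTheory.IwasawaTheory.ClassicalMuVanishesImaginaryQuadraticTwoProofs
import Literature.NumberTheory.IwasawaTheory.FerreroKidaSumParity
import Literature.NumberTheory.QuadraticFields.FundamentalDiscriminant
import Mathlib.Data.Set.Card.Arithmetic
import HarnessLib

/-!
# Genus theory INSIDE the cyclotomic `ℤ₂`-tower of an imaginary quadratic field with odd discriminant:
# `rank₂ Cl(K_n) = t_n − 1` EXACTLY, `t_n = Σ_{ℓ ∣ d_K} #{primes of ℚ_n above ℓ}`, and the χ₈ PARITY LAW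
# `rank₂ Cl(K_n) ≡ #{ℓ ∣ d_K : ℓ ≡ ±3 (8)} − 1 (mod 2)` for `n ≥ 1` (proved; no definition, no named fact)

Topic `NumberTheory/IwasawaTheory` (namespace = path).  THEOREM-ONLY file, written by the prover seat `bsd-line-att-p3` g30 (cell
`bsd-f1-sign2`; `--supports` stmt-BirchSwinnertonDyer-22298; closes nothing).  Sequel of `ClassicalMuVanishesImaginaryQuadraticTwoProofs`
(where the genus count is only BOUNDED: `#Cl(L_n)[2] = 2^{t_n − 1} ≤ 2^{Σ ℓ²}`, enough for `μ₂ = 0`).  Here `K` is an imaginary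
quadratic field with ODD discriminant `d_K` (`2` unramified in `K`), `κ` a cyclotomic `ℤ₂`-extension of `ℚ` with layers `ℚ_n`,
`L_n = j(K)·ℚ_n ≅ (K·ℚ_∞)_n` the `n`-th layer of the cyclotomic `ℤ₂`-extension of `K` (a CM field with `L_n⁺ ≅ ℚ_n`).

* §1 **`natCard_twoTorsion_classGroup_fieldRange_sup_layer_eq`** — **`#Cl(L_n)[2] = 2^{t_n − 1}` with
  `t_n = Σ_{ℓ ∣ d_K} g_n(ℓ)`, `g_n(ℓ) = #{primes of ℚ_n above ℓ}`, and `1 ≤ t_n`**: Okazaki's Lemma 17 for the CM field `L_n`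
  (Weber: `h(ℚ_n)` odd, totally positive units of `ℚ_n` are squares), and the set of finite primes of `L_n⁺` ramified in `L_n` is
  EXACTLY the set of primes above the prime factors of `d_K` — `⊆` as in the parent file (base change of unramifiedness), `⊇`
  because `ℚ_n` is unramified at the odd `ℓ ∣ d_K` (`CyclotomicTwoTowerOddPrimeDecomposition.not_dvd_discr_layer`) while every prime of
  `L_n` above `ℓ` is ramified over `ℚ` (it lies over the ramified prime of `K` above `ℓ`; `e` is multiplicative in towers).
* §2 **`classGroupPRank_restrict_imaginaryQuadratic_two_eq`** — in the tree's tower currency: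
  `rank₂ Cl((K·ℚ_∞)_n) = t_n − 1` for the restriction `κ|_K` (`classGroupPRank`), every `n`.
* §3 THE PARITY LAW: `sum_ncard_primesOver_layer_mod_two` — for `n ≥ 1`, `t_n ≡ #{ℓ ∣ d_K : ℓ ≡ 3, 5 (mod 8)} (mod 2)`
  (`g_n(ℓ)` is odd iff `ℓ ≡ ±3 (8)`); **`classGroupPRank_restrict_mod_two_eq`**; **`odd_classGroupPRank_restrict_iff`** —
  **`rank₂ Cl((K·ℚ_∞)_n)` is ODD (for one / every `n ≥ 1`) iff `|d_K| ≡ ±1 (mod 8)`** (χ₈ is multiplicative, tree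
  `even_card_filter_iff_mod_eight`); at `n = 0`: `classGroupPRank_restrict_zero_eq` — `rank₂ Cl(K) = ω(d_K) − 1` (Gauss).

HONEST SCOPE.  Imaginary quadratic `K` with `d_K` odd, `p = 2`, cyclotomic tower.  For even `d_K` the prime of `ℚ_n` above `2` may or
may not ramify in `L_n` and is not treated.  The exact number `g_n(ℓ) = 2^{min(n, ord₂(ℓ²−1)−3)}` (hence Kida's / Ferrero's value
`λ₂(K) = t_∞ − 1`) is NOT proved here — only `t_n` as a sum and its parity.  Nothing here is specific to any summit; BSD is not proved
by any of this.

## References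
* B. Ferrero, *The cyclotomic ℤ₂-extension of imaginary quadratic fields*, Amer. J. Math. 102 (1980) 447–459, §2 (genus theory in
  the tower). [Ferrero1980AJM]
* Y. Kida, *On cyclotomic ℤ₂-extensions of imaginary quadratic fields*, Tôhoku Math. J. 31 (1979) 91–96, Thm. 1. [Kida1979Tohoku]
* R. Okazaki, Acta Arith. 92 (2000), §3 Lemma 17. [Okazaki2000]
* L. C. Washington, *Introduction to Cyclotomic Fields* (1997), §13.1, Thm. 10.8. [Washington1997]
-/

set_option autoImplicit false

noncomputable section

open scoped NumberField
open NumberField NumberField.IsCMField IsDedekindDomain Field IntermediateField Module Ideal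

namespace Literature.NumberTheory.IwasawaTheory

open Literature.NumberTheory.EllipticCurves Literature.NumberTheory.EllipticCurves.ZpExtension
  Literature.NumberTheory.GaloisRepresentations Literature.NumberTheory.NumberFields
  Literature.NumberTheory.QuadraticFields.Quadratic

/-! ## §1 The exact genus count `#Cl(L_n)[2] = 2^{t_n − 1}` -/

section Genus

variable {κ : ZpExtension ℚ 2} (hκ : κ.IsCyclotomic) (K : Type) [Field K] [NumberField K] (hK : IsImaginaryQuadratic K)
  (j : K →ₐ[ℚ] AlgebraicClosure ℚ) (n : ℕ)

/-- The rational prime under a maximal ideal of a ring of integers (copy of the parent file's private lemma). [folklore] -/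
private theorem exists_prime_liesOver'' {L : Type*} [Field L] [NumberField L] (P : Ideal (𝓞 L)) [P.IsMaximal] :
    ∃ q : ℕ, q.Prime ∧ P.LiesOver (Ideal.span {(q : ℤ)}) := by
  have hP0 : P ≠ ⊥ := Ring.ne_bot_of_isMaximal_of_not_isField ‹_› (RingOfIntegers.not_isField L)
  haveI : (P.under ℤ).IsPrime := Ideal.IsPrime.under ℤ P
  have hPZ0 : P.under ℤ ≠ ⊥ := mt Ideal.eq_bot_of_comap_eq_bot hP0
  set g := Submodule.IsPrincipal.generator (P.under ℤ) with hgdef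
  have hg : Ideal.span {g} = P.under ℤ := Ideal.span_singleton_generator (P.under ℤ)
  have hg0 : g ≠ 0 := fun h => hPZ0 (by rw [← hg, h, Ideal.span_singleton_eq_bot])
  have hgprime : Prime g := (Ideal.span_singleton_prime hg0).mp (hg.symm ▸ inferInstance)
  refine ⟨g.natAbs, Int.prime_iff_natAbs_prime.mp hgprime, ⟨?_⟩⟩
  rw [Int.span_natAbs, hg]

/-- Two rational primes under the same prime ideal are equal. [folklore] -/
private theorem eq_of_liesOver_span {R : Type*} [CommRing R] (P : Ideal R) {p q : ℕ} (hP : P.LiesOver (Ideal.span {(p : ℤ)}))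
    (hQ : P.LiesOver (Ideal.span {(q : ℤ)})) : p = q := by
  have h : Ideal.span {(p : ℤ)} = Ideal.span {(q : ℤ)} := hP.over.trans hQ.over.symm
  have ha : Associated (p : ℤ) (q : ℤ) := Ideal.span_singleton_eq_span_singleton.mp h
  simpa using Int.associated_iff_natAbs.mp ha

/-- For a number field `F` and a prime `ℓ`: the finite places `v` of `F` with `v ∣ ℓ` are in bijection with the primes of `𝓞 F` above `ℓ`
(`v ↦ v.asIdeal`), so the two sets have the same (finite) cardinality. [cite: NeukirchANT1999, Ch. I §9 (9.1) (the finitely many primes above `p`)] -/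
theorem finite_and_ncard_setOf_asIdeal_mem_primesOver (F : Type*) [Field F] [NumberField F] {ℓ : ℕ} (hℓ : ℓ.Prime) :
    ({v : HeightOneSpectrum (𝓞 F) | v.asIdeal ∈ (Ideal.span {(ℓ : ℤ)}).primesOver (𝓞 F)}).Finite ∧
      ({v : HeightOneSpectrum (𝓞 F) | v.asIdeal ∈ (Ideal.span {(ℓ : ℤ)}).primesOver (𝓞 F)}).ncard =
        ((Ideal.span {(ℓ : ℤ)}).primesOver (𝓞 F)).ncard := by
  haveI : Fact ℓ.Prime := ⟨hℓ⟩
  haveI : (Ideal.span {(ℓ : ℤ)}).IsMaximal := Int.ideal_span_isMaximal_of_prime ℓ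
  have hℓ0 : (Ideal.span {(ℓ : ℤ)}) ≠ ⊥ := by
    rw [Ne, Ideal.span_singleton_eq_bot]; exact_mod_cast hℓ.ne_zero
  have hinj : Set.InjOn (fun v : HeightOneSpectrum (𝓞 F) => v.asIdeal)
      {v | v.asIdeal ∈ (Ideal.span {(ℓ : ℤ)}).primesOver (𝓞 F)} := fun v _ v' _ h => HeightOneSpectrum.ext h
  have himage : (fun v : HeightOneSpectrum (𝓞 F) => v.asIdeal) ''
      {v | v.asIdeal ∈ (Ideal.span {(ℓ : ℤ)}).primesOver (𝓞 F)} = (Ideal.span {(ℓ : ℤ)}).primesOver (𝓞 F) := by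
    refine Set.Subset.antisymm ?_ ?_
    · rintro I ⟨v, hv, rfl⟩; exact hv
    · intro I hI
      haveI := hI.1
      haveI := hI.2
      have hI0 : I ≠ ⊥ := Ideal.ne_bot_of_liesOver_of_ne_bot hℓ0 I
      exact ⟨⟨I, hI.1, hI0⟩, hI, rfl⟩
  have hfinT : ((Ideal.span {(ℓ : ℤ)}).primesOver (𝓞 F)).Finite := IsDedekindDomain.primesOver_finite _ _
  have hfin : ({v : HeightOneSpectrum (𝓞 F) | v.asIdeal ∈ (Ideal.span {(ℓ : ℤ)}).primesOver (𝓞 F)}).Finite :=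
    Set.Finite.of_injOn (f := fun v : HeightOneSpectrum (𝓞 F) => v.asIdeal) (fun v hv => hv) hinj hfinT
  exact ⟨hfin, by rw [← hinj.ncard_image, himage]⟩

/-- **A ramified finite prime of `L⁺` (in the CM field `L`) lies above a rational prime ramified in `K`**, whenever `L` is generated over
`L⁺` by the image of a Galois number field `K` (base change of unramifiedness, tree `isUnramifiedIn_of_isUnramifiedIn_span`; the proof of
the parent file's genus bound, isolated). [cite: Washington1997, §13.1] [cite: Okazaki2000, §3 Lemma 17 (proof)] -/
theorem exists_dvd_discr_of_ramificationIdxIn_ne_one (L : Type) [Field L] [NumberField L] [IsCMField L]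
    (K : Type) [Field K] [NumberField K] [IsGalois ℚ K] [Algebra K L]
    (hgen : IntermediateField.adjoin (↥(maximalRealSubfield L)) (Set.range (algebraMap K L)) = ⊤)
    (v : HeightOneSpectrum (𝓞 ↥(maximalRealSubfield L))) (hv : v.asIdeal.ramificationIdxIn (𝓞 L) ≠ 1) :
    ∃ q : ℕ, q.Prime ∧ (q : ℤ) ∣ NumberField.discr K ∧ v.asIdeal.LiesOver (Ideal.span {(q : ℤ)}) := by
  haveI : IsGaloisGroup (L ≃ₐ[↥(maximalRealSubfield L)] L) (𝓞 ↥(maximalRealSubfield L)) (𝓞 L) := IsGaloisGroup.of_isFractionRing _ _ _ (↥(maximalRealSubfield L)) L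
  haveI := v.isPrime
  obtain ⟨⟨Q, hQ, hQv⟩⟩ := v.asIdeal.nonempty_primesOver (S := 𝓞 L)
  haveI := hQ; haveI := hQv
  haveI : Q.IsMaximal := hQ.isMaximal (Ideal.ne_bot_of_liesOver_of_ne_bot v.ne_bot Q)
  obtain ⟨q, hq, hQq⟩ := exists_prime_liesOver'' Q
  haveI := hQq; haveI : Fact q.Prime := ⟨hq⟩
  have hvq : v.asIdeal.LiesOver (Ideal.span {(q : ℤ)}) := Ideal.LiesOver.tower_bot Q v.asIdeal (Ideal.span {(q : ℤ)})
  have hvq' : ((q : ℕ) : 𝓞 ↥(maximalRealSubfield L)) ∈ v.asIdeal := by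
    have : ((q : ℤ) : ℤ) ∈ Ideal.span {(q : ℤ)} := Ideal.mem_span_singleton_self _
    rw [hvq.over, Ideal.under_def, Ideal.mem_comap] at this
    simpa using this
  have hnot : ¬ Algebra.IsUnramifiedIn (𝓞 L) v.asIdeal := fun hunr =>
    hv ((Ideal.ramificationIdxIn_eq_ramificationIdx v.asIdeal Q (L ≃ₐ[↥(maximalRealSubfield L)] L)).trans (hunr.ramificationIdx_eq_one hQv))
  have hqK : ¬ Algebra.IsUnramifiedIn (𝓞 K) (Ideal.span {(q : ℤ)}) := fun hK' =>
    hnot (isUnramifiedIn_of_isUnramifiedIn_span hgen hq hK' v hvq')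
  have hqd : (q : ℤ) ∣ NumberField.discr K := by
    by_contra hnd
    exact hqK ((NumberField.not_dvd_discr_iff_isUnramifiedIn K (𝓞 K) (Nat.prime_iff_prime_int.mp hq)).mp hnd)
  exact ⟨q, hq, hqd, hvq⟩

/-- **A finite prime of `L⁺` above a rational prime `ℓ` which ramifies in the Galois number field `K ⊆ L` but not in `L⁺` is ramified
in the CM field `L`**: for `Q ∣ v ∣ ℓ` in `L ⊇ L⁺ ⊇ ℚ` and `Q ∣ 𝔩 ∣ ℓ` in `L ⊇ K ⊇ ℚ`,
`e(Q∣ℓ) = e(v∣ℓ)·e(Q∣v) = e(Q∣v)` and `e(Q∣ℓ) = e(𝔩∣ℓ)·e(Q∣𝔩)` with `e(𝔩∣ℓ) ≠ 1`. [cite: Washington1997, §13.1]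
[cite: Ferrero1980AJM, §2] -/
theorem ramificationIdxIn_ne_one_of_dvd_discr (L : Type) [Field L] [NumberField L] [IsCMField L]
    (K : Type) [Field K] [NumberField K] [IsGalois ℚ K] [Algebra K L] {ℓ : ℕ} (hℓ : ℓ.Prime)
    (hdK : (ℓ : ℤ) ∣ NumberField.discr K) (hdF : ¬ (ℓ : ℤ) ∣ NumberField.discr ↥(maximalRealSubfield L))
    (v : HeightOneSpectrum (𝓞 ↥(maximalRealSubfield L))) (hv : v.asIdeal ∈ (Ideal.span {(ℓ : ℤ)}).primesOver (𝓞 ↥(maximalRealSubfield L))) :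
    v.asIdeal.ramificationIdxIn (𝓞 L) ≠ 1 := by
  haveI : Fact ℓ.Prime := ⟨hℓ⟩
  have hℓZ : Prime (ℓ : ℤ) := Nat.prime_iff_prime_int.mp hℓ
  haveI : (Ideal.span {(ℓ : ℤ)}).IsMaximal := Int.ideal_span_isMaximal_of_prime ℓ
  haveI : IsGaloisGroup (L ≃ₐ[↥(maximalRealSubfield L)] L) (𝓞 ↥(maximalRealSubfield L)) (𝓞 L) := IsGaloisGroup.of_isFractionRing _ _ _ (↥(maximalRealSubfield L)) L
  haveI := v.isPrime
  haveI : v.asIdeal.LiesOver (Ideal.span {(ℓ : ℤ)}) := hv.2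
  -- Step 1: `e(v ∣ ℓ) = 1`
  have hev : v.asIdeal.ramificationIdx ℤ = 1 := by
    have hunr := (NumberField.not_dvd_discr_iff_isUnramifiedIn ↥(maximalRealSubfield L) (𝓞 ↥(maximalRealSubfield L)) hℓZ).mp hdF
    exact (Algebra.isUnramifiedIn_iff_forall_ramificationIdx_eq_one.mp hunr) v.asIdeal hv.2
  -- a prime `Q` of `L` above `v`, and the prime `𝔩 = Q ∩ 𝓞 K` of `K` below it
  obtain ⟨⟨Q, hQ, hQv⟩⟩ := v.asIdeal.nonempty_primesOver (S := 𝓞 L)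
  haveI := hQ; haveI := hQv
  haveI : Q.IsMaximal := hQ.isMaximal (Ideal.ne_bot_of_liesOver_of_ne_bot v.ne_bot Q)
  haveI hQℓ : Q.LiesOver (Ideal.span {(ℓ : ℤ)}) := Ideal.LiesOver.trans Q v.asIdeal (Ideal.span {(ℓ : ℤ)})
  haveI : (Q.under (𝓞 K)).IsPrime := Ideal.IsPrime.under (𝓞 K) Q
  haveI h𝔩ℓ : (Q.under (𝓞 K)).LiesOver (Ideal.span {(ℓ : ℤ)}) :=
    Ideal.LiesOver.tower_bot Q (Q.under (𝓞 K)) (Ideal.span {(ℓ : ℤ)})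
  -- Step 2: `e(𝔩 ∣ ℓ) ≠ 1`
  have hram : ¬ Algebra.IsUnramifiedIn (𝓞 K) (Ideal.span {(ℓ : ℤ)}) := fun hunr =>
    ((NumberField.not_dvd_discr_iff_isUnramifiedIn K (𝓞 K) hℓZ).mpr hunr) hdK
  have he𝔩 : (Q.under (𝓞 K)).ramificationIdx ℤ ≠ 1 := by
    intro h1
    apply hram
    rw [Algebra.isUnramifiedIn_iff_forall_ramificationIdx_eq_one]
    intro 𝔩' _ h𝔩'
    rw [← Ideal.ramificationIdxIn_eq_ramificationIdx (Ideal.span {(ℓ : ℤ)}) 𝔩' (K ≃ₐ[ℚ] K),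
      Ideal.ramificationIdxIn_eq_ramificationIdx (Ideal.span {(ℓ : ℤ)}) (Q.under (𝓞 K)) (K ≃ₐ[ℚ] K), h1]
  -- Step 3: the two towers
  have hQK : Q.ramificationIdx ℤ = (Q.under (𝓞 K)).ramificationIdx ℤ * Q.ramificationIdx (𝓞 K) :=
    Ideal.ramificationIdx_tower (R := ℤ) (S := 𝓞 K) (T := 𝓞 L) (q := Q.under (𝓞 K)) (r := Q)
  have hQF : Q.ramificationIdx ℤ = v.asIdeal.ramificationIdx ℤ * Q.ramificationIdx (𝓞 ↥(maximalRealSubfield L)) :=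
    Ideal.ramificationIdx_tower (R := ℤ) (S := 𝓞 ↥(maximalRealSubfield L)) (T := 𝓞 L) (q := v.asIdeal) (r := Q)
  have hQne : Q.ramificationIdx (𝓞 ↥(maximalRealSubfield L)) ≠ 1 := by
    intro h1
    rw [hev, h1, mul_one] at hQF
    rw [hQF] at hQK
    exact he𝔩 (Nat.eq_one_of_mul_eq_one_right hQK.symm)
  rwa [Ideal.ramificationIdxIn_eq_ramificationIdx v.asIdeal Q (L ≃ₐ[↥(maximalRealSubfield L)] L)]

include hκ hK in
/-- **Exact genus theory for `L_n = j(K)·ℚ_n`, `K` imaginary quadratic with ODD discriminant**: `L_n` is CM with `L_n⁺ ≅ ℚ_n`, and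
**`#Cl(L_n)[2] = 2^{t_n − 1}`, `t_n = Σ_{ℓ ∣ d_K} #{primes of ℚ_n above ℓ} ≥ 1`** — the finite primes of `L_n⁺` ramified in `L_n`
are exactly those above the (odd) prime divisors of `d_K`: such a prime `v ∣ ℓ` is unramified over `ℚ` (`ℚ_n ⊆ ℚ(ζ_{2^{n+2}})`), while
any prime of `L_n` above it is ramified over `ℚ` (it lies above the ramified prime of `K` above `ℓ`), so `e(L_n/L_n⁺)` at `v` is `≠ 1`;
conversely a ramified `v` lies over a prime ramified in `K`.  Okazaki's Lemma 17 (with Weber's parity inputs on `ℚ_n`) then counts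
`#Cl(L_n)[2]`. [cite: Ferrero1980AJM, §2] [cite: Kida1979Tohoku, Thm. 1 (proof)] [cite: Okazaki2000, §3 Lemma 17] [cite: Washington1997, §13.1] -/
theorem natCard_twoTorsion_classGroup_fieldRange_sup_layer_eq (hd : Odd (NumberField.discr K).natAbs) :
    Nat.card {c : ClassGroup (𝓞 ↥(j.fieldRange ⊔ κ.layer n)) // c ^ 2 = 1} =
        2 ^ ((∑ ℓ ∈ (NumberField.discr K).natAbs.primeFactors,
          ((Ideal.span {(ℓ : ℤ)}).primesOver (𝓞 ↥(κ.layer n))).ncard) - 1) ∧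
      1 ≤ ∑ ℓ ∈ (NumberField.discr K).natAbs.primeFactors, ((Ideal.span {(ℓ : ℤ)}).primesOver (𝓞 ↥(κ.layer n))).ncard := by
  classical
  haveI : FiniteDimensional ℚ ↥(κ.layer n) := κ.finiteDimensional_layer_holds n
  haveI : NumberField ↥(κ.layer n) := NumberField.of_module_finite ℚ _
  haveI : IsTotallyReal ↥(κ.layer n) := isTotallyReal_layer_rat κ n
  haveI : NumberField ↥(j.fieldRange ⊔ κ.layer n) := numberField_fieldRange_sup_layer κ K j n
  have hle : κ.layer n ≤ j.fieldRange ⊔ κ.layer n := le_sup_right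
  letI algL : Algebra ↥(κ.layer n) ↥(j.fieldRange ⊔ κ.layer n) := (IntermediateField.inclusion hle).toRingHom.toAlgebra
  haveI : IsScalarTower ℚ ↥(κ.layer n) ↥(j.fieldRange ⊔ κ.layer n) := IsScalarTower.of_algebraMap_eq fun _ => rfl
  let eK : K →+* ↥(j.fieldRange ⊔ κ.layer n) :=
    (j : K →+* AlgebraicClosure ℚ).codRestrict (j.fieldRange ⊔ κ.layer n) fun x =>
      (le_sup_left : j.fieldRange ≤ j.fieldRange ⊔ κ.layer n) (j.mem_fieldRange.mpr ⟨x, rfl⟩)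
  letI algK : Algebra K ↥(j.fieldRange ⊔ κ.layer n) := eK.toAlgebra
  haveI : IsTotallyComplex K := hK.2
  haveI : IsTotallyComplex ↥(j.fieldRange ⊔ κ.layer n) := isTotallyComplex_of_algebra (F := K) _
  have hsurj := surjective_comp_absGaloisRestrict_imaginaryQuadratic_two hκ K hK
  obtain ⟨eF⟩ := nonempty_algEquiv_layer_restrict_fieldRange_sup_layer κ K hsurj j n
  have hdegF : Module.finrank ℚ ↥(j.fieldRange ⊔ κ.layer n) = 2 ^ n * 2 := by
    have h1 : Module.finrank ℚ ↥((κ.restrict K hsurj).layer n) = Module.finrank ℚ ↥(j.fieldRange ⊔ κ.layer n) :=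
      eF.toLinearEquiv.finrank_eq
    have h2 := finrank_layer_restrict κ K hsurj n
    rw [hK.1] at h2
    omega
  haveI : Module.Free ↥(κ.layer n) ↥(j.fieldRange ⊔ κ.layer n) := Module.Free.of_divisionRing _ _
  haveI : Algebra.IsQuadraticExtension ↥(κ.layer n) ↥(j.fieldRange ⊔ κ.layer n) := by
    refine { finrank_eq_two' := ?_ }
    have h1 := Module.finrank_mul_finrank ℚ ↥(κ.layer n) ↥(j.fieldRange ⊔ κ.layer n)
    rw [κ.finrank_layer_holds n, hdegF] at h1
    exact Nat.eq_of_mul_eq_mul_left (pow_pos two_pos n) h1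
  haveI : IsCMField ↥(j.fieldRange ⊔ κ.layer n) := IsCMField.ofCMExtension ↥(κ.layer n) _
  let e := CMExtension.equivMaximalRealSubfield ↥(κ.layer n) ↥(j.fieldRange ⊔ κ.layer n)
  -- Okazaki on `L_n` (Weber's inputs on `ℚ_n`, transported to `L_n⁺` along `e`)
  obtain ⟨hoddL, hsqL⟩ := odd_classNumber_and_forall_isSquare_layer_two hκ n
  have hoddF : Odd (classNumber (maximalRealSubfield ↥(j.fieldRange ⊔ κ.layer n))) := odd_classNumber_of_ringEquiv e hoddL
  have hsqF := forall_isSquare_of_totallyPositive_of_ringEquiv e hsqL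
  have ht1 := IsCMField.one_le_card_ramified_of_odd_of_forall_isSquare _ hoddF hsqF
  rw [IsCMField.card_twoTorsion_classGroup_eq_two_pow_of_odd_of_forall_isSquare _ hoddF hsqF]
  -- notation: `L = j(K)·ℚ_n`, `Fp = L⁺`, `P` = prime factors of `|d_K|`
  set Fp := maximalRealSubfield ↥(j.fieldRange ⊔ κ.layer n) with hFp
  set P := (NumberField.discr K).natAbs.primeFactors with hP
  have hdisc : NumberField.discr K ≠ 0 := NumberField.discr_ne_zero K
  haveI : Module.Free ℚ K := Module.Free.of_divisionRing _ _
  haveI : Algebra.IsQuadraticExtension ℚ K := { finrank_eq_two' := hK.1 }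
  haveI : IsGalois ℚ K := Algebra.IsQuadraticExtension.isGalois ℚ K
  -- every prime factor of `d_K` is an odd prime
  have hPodd : ∀ ℓ ∈ P, ℓ.Prime ∧ ℓ ≠ 2 := by
    intro ℓ hℓ
    refine ⟨Nat.prime_of_mem_primeFactors hℓ, fun h2 => ?_⟩
    rw [h2] at hℓ
    exact (Nat.not_even_iff_odd.mpr hd) (even_iff_two_dvd.mpr (Nat.dvd_of_mem_primeFactors hℓ))
  -- `L` is generated over `L⁺` by the image of `K` (otherwise `K` would embed in the totally real `L⁺`)
  have hgen : IntermediateField.adjoin (↥Fp) (Set.range (algebraMap K ↥(j.fieldRange ⊔ κ.layer n))) = ⊤ := by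
    set E := IntermediateField.adjoin (↥Fp) (Set.range (algebraMap K ↥(j.fieldRange ⊔ κ.layer n))) with hE
    have h2 : (Module.finrank (↥Fp) ↥(j.fieldRange ⊔ κ.layer n)).Prime := by
      rw [(IsCMField.isQuadraticExtension ↥(j.fieldRange ⊔ κ.layer n)).finrank_eq_two]; exact Nat.prime_two
    haveI := IntermediateField.isSimpleOrder_of_finrank_prime (↥Fp) ↥(j.fieldRange ⊔ κ.layer n) h2
    rcases eq_bot_or_eq_top E with h | h
    · exfalso
      have hmemFp : ∀ x : K, algebraMap K ↥(j.fieldRange ⊔ κ.layer n) x ∈ Fp := fun x => by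
        obtain ⟨y, hy⟩ := IntermediateField.mem_bot.mp (h ▸ IntermediateField.subset_adjoin _ _ ⟨x, rfl⟩ :
          algebraMap K ↥(j.fieldRange ⊔ κ.layer n) x ∈ (⊥ : IntermediateField ↥Fp ↥(j.fieldRange ⊔ κ.layer n)))
        exact hy ▸ y.2
      letI : Algebra K ↥Fp := ((algebraMap K ↥(j.fieldRange ⊔ κ.layer n)).codRestrict Fp hmemFp).toAlgebra
      haveI : IsScalarTower ℚ K ↥Fp := IsScalarTower.of_algebraMap_eq' (Subsingleton.elim _ _)
      haveI : Algebra.IsAlgebraic K ↥Fp :=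
        Algebra.IsAlgebraic.extendScalars (R := ℚ) (S := K) (A := ↥Fp) (algebraMap ℚ K).injective
      haveI : IsTotallyReal K := IsTotallyReal.of_algebra K ↥Fp
      obtain ⟨w⟩ := (inferInstance : Nonempty (InfinitePlace K))
      exact (InfinitePlace.not_isReal_iff_isComplex.mpr (IsTotallyComplex.isComplex w)) (IsTotallyReal.isReal w)
    · exact h
  -- `ℚ_n ≅ L⁺` as `ℚ`-algebras, so `ℓ ∤ d(L⁺)` for odd `ℓ`
  have eQ : ↥(κ.layer n) ≃ₐ[ℚ] ↥Fp := AlgEquiv.ofRingEquiv (f := e) fun q => by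
    rw [eq_ratCast (algebraMap ℚ ↥(κ.layer n)) q, map_ratCast, eq_ratCast (algebraMap ℚ ↥Fp) q]
  have hdF : ∀ ℓ ∈ P, ¬ (ℓ : ℤ) ∣ NumberField.discr ↥Fp := fun ℓ hℓ => by
    rw [← NumberField.discr_eq_discr_of_algEquiv ↥(κ.layer n) eQ]
    exact not_dvd_discr_layer hκ n (hPodd ℓ hℓ).1 (hPodd ℓ hℓ).2
  -- (⊆) every ramified prime of `L⁺` lies over a prime factor of `d_K`
  have hcover : {v : HeightOneSpectrum (𝓞 ↥Fp) | v.asIdeal.ramificationIdxIn (𝓞 ↥(j.fieldRange ⊔ κ.layer n)) ≠ 1} ⊆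
      ⋃ ℓ ∈ (P : Set ℕ), {v : HeightOneSpectrum (𝓞 ↥Fp) | v.asIdeal ∈ (Ideal.span {(ℓ : ℤ)}).primesOver (𝓞 ↥Fp)} := by
    intro v hv
    obtain ⟨q, hq, hqd, hvq⟩ := exists_dvd_discr_of_ramificationIdxIn_ne_one ↥(j.fieldRange ⊔ κ.layer n) K hgen v hv
    refine Set.mem_biUnion (x := q) ?_ ?_
    · exact Finset.mem_coe.mpr (Nat.mem_primeFactors.mpr
        ⟨hq, Int.natAbs_dvd_natAbs.mpr hqd |>.trans (by simp), Int.natAbs_ne_zero.mpr hdisc⟩)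
    · exact ⟨v.isPrime, hvq⟩
  -- (⊇) every prime of `L⁺` above a prime factor `ℓ` of `d_K` is ramified in `L`
  have hconv : ∀ ℓ ∈ P, ∀ v : HeightOneSpectrum (𝓞 ↥Fp), v.asIdeal ∈ (Ideal.span {(ℓ : ℤ)}).primesOver (𝓞 ↥Fp) →
      v.asIdeal.ramificationIdxIn (𝓞 ↥(j.fieldRange ⊔ κ.layer n)) ≠ 1 := fun ℓ hℓP v hv =>
    ramificationIdxIn_ne_one_of_dvd_discr ↥(j.fieldRange ⊔ κ.layer n) K (hPodd ℓ hℓP).1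
      (Int.ofNat_dvd_left.mpr (Nat.dvd_of_mem_primeFactors hℓP)) (hdF ℓ hℓP) v hv
  -- the ramified set is exactly the union
  have hfinS : ∀ ℓ ∈ P, ({v : HeightOneSpectrum (𝓞 ↥Fp) | v.asIdeal ∈ (Ideal.span {(ℓ : ℤ)}).primesOver (𝓞 ↥Fp)}).Finite ∧
      ({v : HeightOneSpectrum (𝓞 ↥Fp) | v.asIdeal ∈ (Ideal.span {(ℓ : ℤ)}).primesOver (𝓞 ↥Fp)}).ncard =
        ((Ideal.span {(ℓ : ℤ)}).primesOver (𝓞 ↥(κ.layer n))).ncard := fun ℓ hℓ => by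
    obtain ⟨h1, h2⟩ := finite_and_ncard_setOf_asIdeal_mem_primesOver ↥Fp (hPodd ℓ hℓ).1
    exact ⟨h1, by rw [h2, ← ncard_primesOver_eq_of_ringEquiv e ℓ]⟩
  have hdisj : (P : Set ℕ).PairwiseDisjoint
      (fun ℓ => {v : HeightOneSpectrum (𝓞 ↥Fp) | v.asIdeal ∈ (Ideal.span {(ℓ : ℤ)}).primesOver (𝓞 ↥Fp)}) := by
    intro ℓ hℓ ℓ' hℓ' hne
    refine Set.disjoint_left.mpr fun v hv hv' => hne ?_
    haveI := v.isPrime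
    exact eq_of_liesOver_span v.asIdeal hv.2 hv'.2
  have hReq : {v : HeightOneSpectrum (𝓞 ↥Fp) | v.asIdeal.ramificationIdxIn (𝓞 ↥(j.fieldRange ⊔ κ.layer n)) ≠ 1} =
      ⋃ ℓ ∈ (P : Set ℕ), {v : HeightOneSpectrum (𝓞 ↥Fp) | v.asIdeal ∈ (Ideal.span {(ℓ : ℤ)}).primesOver (𝓞 ↥Fp)} := by
    refine Set.Subset.antisymm hcover ?_
    intro v hv
    obtain ⟨ℓ, hℓ, hv⟩ := Set.mem_iUnion₂.mp hv
    exact hconv ℓ (Finset.mem_coe.mp hℓ) v hv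
  have hcount : {v : HeightOneSpectrum (𝓞 ↥Fp) | v.asIdeal.ramificationIdxIn (𝓞 ↥(j.fieldRange ⊔ κ.layer n)) ≠ 1}.ncard =
      ∑ ℓ ∈ P, ((Ideal.span {(ℓ : ℤ)}).primesOver (𝓞 ↥(κ.layer n))).ncard := by
    rw [hReq, Set.Finite.ncard_biUnion P.finite_toSet (fun ℓ hℓ => (hfinS ℓ (Finset.mem_coe.mp hℓ)).1) hdisj,
      finsum_mem_coe_finset]
    exact Finset.sum_congr rfl fun ℓ hℓ => (hfinS ℓ hℓ).2
  refine ⟨by rw [hcount], ?_⟩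
  rw [← hcount]
  exact ht1

end Genus

/-! ## §2 Tower currency: `rank₂ Cl((K·ℚ_∞)_n) = t_n − 1` -/

section Rank

variable {κ : ZpExtension ℚ 2} (hκ : κ.IsCyclotomic) (K : Type) [Field K] [NumberField K] (hK : IsImaginaryQuadratic K)

/-- **`rank₂ Cl((K·ℚ_∞)_n) = t_n − 1`** (and `1 ≤ t_n`) for every `n`, `K` imaginary quadratic with odd `d_K`, `ℚ_∞/ℚ` a cyclotomic
`ℤ₂`-extension restricted to `Γ_K`: the layer `(K·ℚ_∞)_n ≅ j(K)·ℚ_n`, `#Cl[2] = 2^{rank₂}`, and §1. [cite: Ferrero1980AJM, §2]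
[cite: Kida1979Tohoku, Thm. 1 (proof)] -/
theorem classGroupPRank_restrict_imaginaryQuadratic_two_eq (hd : Odd (NumberField.discr K).natAbs) (n : ℕ) :
    classGroupPRank (κ.restrict K (surjective_comp_absGaloisRestrict_imaginaryQuadratic_two hκ K hK)) n =
        (∑ ℓ ∈ (NumberField.discr K).natAbs.primeFactors, ((Ideal.span {(ℓ : ℤ)}).primesOver (𝓞 ↥(κ.layer n))).ncard) - 1 ∧
      1 ≤ ∑ ℓ ∈ (NumberField.discr K).natAbs.primeFactors, ((Ideal.span {(ℓ : ℤ)}).primesOver (𝓞 ↥(κ.layer n))).ncard := by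
  have hsurj := surjective_comp_absGaloisRestrict_imaginaryQuadratic_two hκ K hK
  obtain ⟨eF⟩ := nonempty_algEquiv_layer_restrict_fieldRange_sup_layer κ K hsurj (absEmbedding ℚ K) n
  have h1 := natCard_torsion_classGroup_layer_eq (κ.restrict K hsurj) n
  have h2 := natCard_twoTorsion_classGroup_eq_of_ringEquiv eF.toRingEquiv
  obtain ⟨h3, ht⟩ := natCard_twoTorsion_classGroup_fieldRange_sup_layer_eq hκ K hK (absEmbedding ℚ K) n hd
  refine ⟨Nat.pow_right_injective (le_refl 2) ?_, ht⟩
  simp only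
  rw [← h1, h2]
  exact h3

end Rank

/-! ## §3 The χ₈ parity law -/

section Parity

variable {κ : ZpExtension ℚ 2} (hκ : κ.IsCyclotomic)

include hκ in
/-- **`t_n ≡ #{ℓ ∣ d : ℓ ≡ 3, 5 (mod 8)} (mod 2)` for `n ≥ 1`** and any ODD `d`: the number of primes of `ℚ_n` above an odd `ℓ` is odd
iff `ℓ ≡ ±3 (mod 8)` (`odd_ncard_primesOver_layer_iff`). [cite: Washington1997, §13.1] -/
theorem sum_ncard_primesOver_layer_mod_two {d : ℕ} (hodd : Odd d) {n : ℕ} (hn : 1 ≤ n) :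
    (∑ ℓ ∈ d.primeFactors, ((Ideal.span {(ℓ : ℤ)}).primesOver (𝓞 ↥(κ.layer n))).ncard) % 2 =
      (d.primeFactors.filter (fun ℓ => ℓ % 8 = 3 ∨ ℓ % 8 = 5)).card % 2 := by
  classical
  haveI : FiniteDimensional ℚ ↥(κ.layer n) := κ.finiteDimensional_layer_holds n
  haveI : NumberField ↥(κ.layer n) := NumberField.of_module_finite ℚ _
  rw [Finset.card_filter, Finset.sum_nat_mod]
  congr 1
  refine Finset.sum_congr rfl fun ℓ hℓ => ?_
  have hprime : ℓ.Prime := Nat.prime_of_mem_primeFactors hℓ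
  have hℓ2 : ℓ ≠ 2 := fun h => by
    rw [h] at hℓ
    exact (Nat.not_even_iff_odd.mpr hodd) (even_iff_two_dvd.mpr (Nat.dvd_of_mem_primeFactors hℓ))
  have key := odd_ncard_primesOver_layer_iff hκ hn hprime hℓ2
  by_cases h35 : ℓ % 8 = 3 ∨ ℓ % 8 = 5
  · rw [if_pos h35]
    exact Nat.odd_iff.mp (key.mpr h35)
  · rw [if_neg h35]
    exact Nat.even_iff.mp (Nat.not_odd_iff_even.mp (fun h => h35 (key.mp h)))

variable (K : Type) [Field K] [NumberField K] (hK : IsImaginaryQuadratic K)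

/-- For a quadratic field with odd discriminant, `|d_K|` is squarefree (`d_K ≡ 1 (mod 4)` is a fundamental discriminant).
[cite: Washington1997, §13.1] -/
theorem squarefree_natAbs_discr_of_odd (h2 : Module.finrank ℚ K = 2) (hd : Odd (NumberField.discr K).natAbs) :
    Squarefree (NumberField.discr K).natAbs := by
  rcases isFundamentalDiscriminant_discr (K := K) h2 with ⟨-, hsf, -⟩ | ⟨h4, -, -⟩
  · exact Int.squarefree_natAbs.mpr hsf
  · exfalso
    have : 2 ∣ (NumberField.discr K).natAbs := Int.ofNat_dvd_left.mp (dvd_trans ⟨2, by norm_num⟩ h4)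
    exact (Nat.not_even_iff_odd.mpr hd) (even_iff_two_dvd.mpr this)

include hκ hK in
/-- **THE χ₈ PARITY LAW**: for `K` imaginary quadratic with odd `d_K` and `n ≥ 1`,
**`rank₂ Cl((K·ℚ_∞)_n) % 2 = (#{ℓ ∣ d_K : ℓ ≡ 3, 5 (mod 8)} − 1) % 2`** — i.e. `rank₂ Cl(K_n) + 1 ≡ #{ℓ ∣ d_K : ℓ ≡ ±3 (8)} (mod 2)`.
[cite: Ferrero1980AJM, §2] [cite: Washington1997, §13.1 and Thm. 10.8] -/
theorem classGroupPRank_restrict_succ_mod_two_eq (hd : Odd (NumberField.discr K).natAbs) {n : ℕ} (hn : 1 ≤ n) :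
    (classGroupPRank (κ.restrict K (surjective_comp_absGaloisRestrict_imaginaryQuadratic_two hκ K hK)) n + 1) % 2 =
      ((NumberField.discr K).natAbs.primeFactors.filter (fun ℓ => ℓ % 8 = 3 ∨ ℓ % 8 = 5)).card % 2 := by
  obtain ⟨hr, ht⟩ := classGroupPRank_restrict_imaginaryQuadratic_two_eq hκ K hK hd n
  rw [hr, Nat.sub_add_cancel ht]
  exact sum_ncard_primesOver_layer_mod_two hκ hd hn

include hκ hK in
/-- **`rank₂ Cl((K·ℚ_∞)_n)` is ODD for every `n ≥ 1` iff `|d_K| ≡ ±1 (mod 8)`** (`K` imaginary quadratic, `d_K` odd; `χ₈(|d_K|) =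
(−1)^{#{ℓ ∣ d_K : ℓ ≡ ±3 (8)}}`). [cite: Ferrero1980AJM, §2] [cite: Washington1997, Thm. 10.8] -/
theorem odd_classGroupPRank_restrict_iff (hd : Odd (NumberField.discr K).natAbs) {n : ℕ} (hn : 1 ≤ n) :
    Odd (classGroupPRank (κ.restrict K (surjective_comp_absGaloisRestrict_imaginaryQuadratic_two hκ K hK)) n) ↔
      ((NumberField.discr K).natAbs % 8 = 1 ∨ (NumberField.discr K).natAbs % 8 = 7) := by
  have hsf := squarefree_natAbs_discr_of_odd K hK.1 hd
  rw [← even_card_filter_iff_mod_eight hsf hd, Nat.even_iff, ← classGroupPRank_restrict_succ_mod_two_eq hκ K hK hd hn,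
    Nat.odd_iff]
  omega

include hκ hK in
/-- **`rank₂ Cl((K·ℚ_∞)_n)` is EVEN for every `n ≥ 1` iff `|d_K| ≡ ±3 (mod 8)`** (`d_K` odd). [cite: Ferrero1980AJM, §2]
[cite: Washington1997, Thm. 10.8] -/
theorem even_classGroupPRank_restrict_iff (hd : Odd (NumberField.discr K).natAbs) {n : ℕ} (hn : 1 ≤ n) :
    Even (classGroupPRank (κ.restrict K (surjective_comp_absGaloisRestrict_imaginaryQuadratic_two hκ K hK)) n) ↔
      ((NumberField.discr K).natAbs % 8 = 3 ∨ (NumberField.discr K).natAbs % 8 = 5) := by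
  have h := odd_classGroupPRank_restrict_iff hκ K hK hd hn
  have h8 : (NumberField.discr K).natAbs % 8 = 1 ∨ (NumberField.discr K).natAbs % 8 = 3 ∨
      (NumberField.discr K).natAbs % 8 = 5 ∨ (NumberField.discr K).natAbs % 8 = 7 := by
    have := Nat.odd_iff.mp hd; omega
  rw [← Nat.not_odd_iff_even, h]
  omega

include hκ hK in
/-- **Layer `0` (Gauss): `rank₂ Cl(K) = ω(d_K) − 1`** in the tower currency (`g_0(ℓ) = 1` for every `ℓ`), `d_K` odd.
[cite: Washington1997, §13.1] [cite: Okazaki2000, §3 Lemma 17] -/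
theorem classGroupPRank_restrict_zero_eq (hd : Odd (NumberField.discr K).natAbs) :
    classGroupPRank (κ.restrict K (surjective_comp_absGaloisRestrict_imaginaryQuadratic_two hκ K hK)) 0 =
      (NumberField.discr K).natAbs.primeFactors.card - 1 := by
  obtain ⟨hr, -⟩ := classGroupPRank_restrict_imaginaryQuadratic_two_eq hκ K hK hd 0
  rw [hr, Finset.card_eq_sum_ones]
  congr 1
  exact Finset.sum_congr rfl fun ℓ hℓ => ncard_primesOver_layer_zero κ (Nat.prime_of_mem_primeFactors hℓ)

end Parity

end Literature.NumberTheory.IwasawaTheory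

end
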